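import Mathlib
import Summits.MatrixMultiplication.MatrixMultiplication.Theorems.GradedDesignFamily.Negative.CuspFormWallSharp
import Summits.MatrixMultiplication.MatrixMultiplication.Theorems.GradedDesignFamily.Negative.SubfieldCellTwentyfiveWallSharpRel0
import Summits.MatrixMultiplication.MatrixMultiplication.Theorems.GradedDesignFamily.Negative.SubfieldCellTwentyfiveWallSharpRel1
import Summits.MatrixMultiplication.MatrixMultiplication.Theorems.GradedDesignFamily.Negative.SubfieldCellTwentyfiveWallSharpRel2
import Summits.MatrixMultiplication.MatrixMultiplication.Theorems.GradedDesignFamily.Negative.SubfieldCellTwentyfiveWallSharpRel3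
import Summits.MatrixMultiplication.MatrixMultiplication.Theorems.GradedDesignFamily.Negative.SubfieldCellTwentyfiveWallSharpRel4

/-!
# The EXACT wall `|Y| + |Z| ≤ 104` of the `|K| = 25` subfield cell (standard model)
# (crux `LevelGradedCohnUmans.GradedDesignFamily`, stmt-MatrixMultiplication-7610; negative side,
# line `quadratic-extension-level-one-cell`, stub S3 `stub_subfieldCell`, cell `q = 5`; gen 14, unit b2b-lgcu-subfield-g14)

HONEST FRAMING.  The stub `stub_subfieldCell` is ASYMPTOTIC; these files decide nothing about it or the summit.  They prove a
THEOREM about ONE finite cell: in the standard model `k = 𝔽₅ = ZMod 5`, `K = 𝔽₂₅ = QuadraticAlgebra (ZMod 5) 2 0` (`i² = 2`),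
`φ = Matrix.SpecialLinearGroup.mapGL K`, every separated design `(Y, Z)` of S3's clause has `|Y| + |Z| ≤ 104`
(`subfieldCell_twentyfive_wall_sharp`, file `SubfieldCellTwentyfiveWallSharp.lean`); with gen 14's row-one instance
`subfieldCell_twentyfive_witnessN` (`(|Y|, |Z|) = (1, 103)`) the maximum of `|Y| + |Z|` over the standard `q = 5` cell is EXACTLY `104`,
both sides theorems.  VALUE = THEOREM / CERTIFICATE, NOT summit progress.
The `q = 3`, `q = 4` analogues: `20` (`subfieldCell_nine_wall_twenty` / `(1, 19)`) and `51` (`subfieldCell_sixteen_wall_sharp[_any]` /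
`(1, 50)`).  The relation-free wall `subfieldCell_twentyfive_wall` (`≤ 105`, any `(k, K, φ)` with `|k| = 5`,
`Negative/SubfieldCellTwentyfiveCubes.lean`) and the exponent-three ceiling there are untouched; nothing is claimed here for a general
injective `φ` (no `q = 5` embedding classification is formalised).

METHOD = the sharp engine `cuspFormWall_sharp` (`Negative/CuspFormWallSharp.lean`) with the EVEN cusp form `e = χ₄ ∘ (SL₂(𝔽₅) → A₅)`
(cuspidality `Σ_x e(g b u_x b⁻¹) = 0` checked on all `120²` pairs in the data file): `r·(|Y| + |Z| − 1) ≤ 26 · rk T₂ − 1 = 26 · 4r − 1`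
once ONE non-zero kernel vector of the line parametrisation `Ψ₁ : (d_ℓ)_ℓ ↦ (g ↦ Σ_ℓ d_ℓ(g ℓ))` (`d_ℓ ∈ range T₂`) is exhibited, and
integrality gives `≤ 104`.  WHY THE EVEN FORM, AND WHERE THE VECTOR COMES FROM.  For an isotypic cusp form `e = χ_ρ` the kernel of
`Ψ₁` is exactly the diagonal `d_ℓ = d`, `d : P¹(K) → ℂ` a `ρ`-isotypic function on the LINES orthogonal to constants: the frame
(level-one) functions on `GL₂(K)` are the matrix coefficients of the irreducibles with a mirabolic-fixed vector (`1`, `St` and the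
principal series `Ind(χ, 1)`), line `ℓ` contributes the `P_ℓ`-fixed vector of each, and only for `St` (`|K| + 1 = 26` fixed vectors in
dimension `|K| = 25`) is there a relation; hence `dim ker Ψ₁(χ_ρ) = dim ρ · ⟨Res^{GL₂(𝔽₂₅)}_{SL₂(𝔽₅)} St, ρ⟩`.  Since `−1 ∈ SL₂(𝔽₅)` is
central in `GL₂(𝔽₂₅)` it acts trivially on `St`, so every ODD cuspidal `ρ` (the faithful `4`, `2`, `2′`; the trace form `τ ∘ tr`
of `SubfieldCellTwentyfiveCubes` is odd) has kernel ZERO — confirmed by kit j143944 (`rk Ψ₁ = 2496 =` all unknowns) and j146399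
(`two2`, `odd4`: kernel `0`) — while `χ_St|_{A₅} = (25, 1, 1, 0, 0)` contains `χ₄` twice: kernel dimension `8` (`stkernel.py`;
j146399 `even4`: `8`, all verified); the `q = 4` kernel dimension `6 = 3·1 + 3·1` behind `SubfieldCellSixteenWallSharp` is the same
formula.  Here `κ = d/30` is such a line function (data file), `T₂ κ = 30 κ` (`…_sharp_table`), THE RELATION is the five block files,
`T₂ κ ≠ 0` is `…_sharp_nonzero`.

LEAN (this file): the five relation blocks are dispatched by cases on `(g 0 0).im ∈ ZMod 5` inside the proof; the wall is
`cuspFormWall_sharp` + cast book-keeping for an ARBITRARY `Fintype` instance on `𝔽₂₅` (transported by `Subsingleton.elim`).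
Axioms: `propext`, `Classical.choice`, `Quot.sound`, `Lean.ofReduceBool`.
-/

set_option linter.dupNamespace false
set_option linter.style.longLine false
set_option linter.style.setOption false

open scoped BigOperators
open Matrix Module

namespace Summit.MatrixMultiplication.MatrixMultiplication.Theorems.GradedDesignFamily.Negative

/-- The five values of `ZMod 5` (block dispatch). -/
theorem subfieldCell_twentyfive_sharp_zmod_cases : ∀ i : ZMod 5, i = 0 ∨ i = 1 ∨ i = 2 ∨ i = 3 ∨ i = 4 := by decide

/-- **The exact wall of the `|K| = 25` subfield cell (standard model): `|Y| + |Z| ≤ 104`.**  For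
`k = ZMod 5`, `K = 𝔽₂₅` (as a `QuadraticAlgebra`, any `Fintype` instance) and `φ = mapGL K`, every separated
design of S3's clause has `|Y| + |Z| ≤ 104`; attained by `subfieldCell_twentyfive_witnessN` (`(1, 103)`).
A THEOREM about one finite cell — NOT summit progress. [folklore] -/
theorem subfieldCell_twentyfive_wall_sharp
    [hp5 : Fact (Nat.Prime 5)]
    [hF : Fact (∀ r : ZMod 5, r ^ 2 ≠ 2 + 0 * r)]
    [iK25 : Fintype (QuadraticAlgebra (ZMod 5) 2 0)]
    (Y Z : Finset (GL (Fin 2) (QuadraticAlgebra (ZMod 5) 2 0))) (hY : Y.Nonempty) (hZ : Z.Nonempty)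
    (hsep : ∀ z₀ ∈ Z, ∃ cf : (Fin 2 → QuadraticAlgebra (ZMod 5) 2 0) → (Fin 2 → QuadraticAlgebra (ZMod 5) 2 0) → ℂ,
      ∀ a : Matrix.SpecialLinearGroup (Fin 2) (ZMod 5), ∀ y ∈ Y, ∀ y' ∈ Y, ∀ z ∈ Z,
        (∑ u : Fin 2 → QuadraticAlgebra (ZMod 5) 2 0, cf u (((Matrix.SpecialLinearGroup.mapGL (QuadraticAlgebra (ZMod 5) 2 0) a * y * y'⁻¹ * z : GL (Fin 2) (QuadraticAlgebra (ZMod 5) 2 0)) :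
            Matrix (Fin 2) (Fin 2) (QuadraticAlgebra (ZMod 5) 2 0)).mulVec u)) =
          if a = 1 ∧ y = y' ∧ z = z₀ then 1 else 0) :
    Y.card + Z.card ≤ 104 := by
  have hI25 : (Fintype.ofEquiv _ (QuadraticAlgebra.equivProd (2 : ZMod 5) 0).symm : Fintype (QuadraticAlgebra (ZMod 5) 2 0)) = iK25 := Subsingleton.elim _ _
  have tab := subfieldCell_twentyfive_sharp_table
  have rel0 := subfieldCell_twentyfive_sharp_rel0
  have rel1 := subfieldCell_twentyfive_sharp_rel1
  have rel2 := subfieldCell_twentyfive_sharp_rel2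
  have rel3 := subfieldCell_twentyfive_sharp_rel3
  have rel4 := subfieldCell_twentyfive_sharp_rel4
  rw [hI25] at tab rel0 rel1 rel2 rel3 rel4
  -- cardinalities, injectivity of `φ`
  have h5 : Fintype.card (ZMod 5) = 5 := ZMod.card 5
  have h25 : Fintype.card (QuadraticAlgebra (ZMod 5) 2 0) = 25 := by
    rw [← hI25]; rfl
  have hK : Fintype.card (QuadraticAlgebra (ZMod 5) 2 0) = Fintype.card (ZMod 5) ^ 2 := by
    rw [h5, h25]; norm_num
  have hφ : Function.Injective (Matrix.SpecialLinearGroup.mapGL (n := Fin 2) (R := ZMod 5) (QuadraticAlgebra (ZMod 5) 2 0)) := by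
    intro a a' h
    have h' := congrArg (fun w : GL (Fin 2) (QuadraticAlgebra (ZMod 5) 2 0) => (w : Matrix (Fin 2) (Fin 2) (QuadraticAlgebra (ZMod 5) 2 0))) h
    simp only [Matrix.SpecialLinearGroup.mapGL_coe_matrix] at h'
    exact Subtype.ext (Matrix.map_injective (algebraMap (ZMod 5) (QuadraticAlgebra (ZMod 5) 2 0)).injective h')
  have hbij : Function.Bijective subfieldCell_twentyfive_sharp_sl :=
    ⟨subfieldCell_twentyfive_sharp_slinj, fun a => subfieldCell_twentyfive_sharp_slsurj a (Finset.mem_univ a)⟩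
  -- the even cusp form: cuspidality and non-vanishing
  have hcusp : ∀ g b : Matrix.SpecialLinearGroup (Fin 2) (ZMod 5), ∑ x : ZMod 5,
      ((subfieldCell_twentyfive_sharp_e ((g * b * ⟨!![(1 : ZMod 5), x; 0, 1], sl2md_det_upper x⟩ * b⁻¹ : Matrix.SpecialLinearGroup (Fin 2) (ZMod 5)) :
        Matrix (Fin 2) (Fin 2) (ZMod 5)) : ℤ) : ℂ) = 0 := by
    intro g b
    have hg : (g : Matrix (Fin 2) (Fin 2) (ZMod 5)) 0 0 * (g : Matrix (Fin 2) (Fin 2) (ZMod 5)) 1 1 - (g : Matrix (Fin 2) (Fin 2) (ZMod 5)) 0 1 * (g : Matrix (Fin 2) (Fin 2) (ZMod 5)) 1 0 = 1 := by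
      rw [← Matrix.det_fin_two]; exact g.prop
    have hb : (b : Matrix (Fin 2) (Fin 2) (ZMod 5)) 0 0 * (b : Matrix (Fin 2) (Fin 2) (ZMod 5)) 1 1 - (b : Matrix (Fin 2) (Fin 2) (ZMod 5)) 0 1 * (b : Matrix (Fin 2) (Fin 2) (ZMod 5)) 1 0 = 1 := by
      rw [← Matrix.det_fin_two]; exact b.prop
    have h := subfieldCell_twentyfive_sharp_cusp (g : Matrix (Fin 2) (Fin 2) (ZMod 5)) (Finset.mem_univ _) hg (b : Matrix (Fin 2) (Fin 2) (ZMod 5)) (Finset.mem_univ _) hb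
    have hcoe : ∀ x : ZMod 5, ((g * b * ⟨!![(1 : ZMod 5), x; 0, 1], sl2md_det_upper x⟩ * b⁻¹ : Matrix.SpecialLinearGroup (Fin 2) (ZMod 5)) : Matrix (Fin 2) (Fin 2) (ZMod 5)) =
        (g : Matrix (Fin 2) (Fin 2) (ZMod 5)) * (b : Matrix (Fin 2) (Fin 2) (ZMod 5)) * !![1, x; 0, 1] * !![(b : Matrix (Fin 2) (Fin 2) (ZMod 5)) 1 1, -(b : Matrix (Fin 2) (Fin 2) (ZMod 5)) 0 1; -(b : Matrix (Fin 2) (Fin 2) (ZMod 5)) 1 0, (b : Matrix (Fin 2) (Fin 2) (ZMod 5)) 0 0] := by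
      intro x
      rw [Matrix.SpecialLinearGroup.coe_mul, Matrix.SpecialLinearGroup.coe_mul,
        Matrix.SpecialLinearGroup.coe_mul, Matrix.SpecialLinearGroup.coe_inv, Matrix.adjugate_fin_two]
    simp only [hcoe]
    exact_mod_cast h
  have he : ∃ a : Matrix.SpecialLinearGroup (Fin 2) (ZMod 5), (fun M : Matrix.SpecialLinearGroup (Fin 2) (ZMod 5) => (subfieldCell_twentyfive_sharp_e (M : Matrix (Fin 2) (Fin 2) (ZMod 5)) : ℂ)) a ≠ 0 := by
    refine ⟨1, ?_⟩
    show (subfieldCell_twentyfive_sharp_e ((1 : Matrix.SpecialLinearGroup (Fin 2) (ZMod 5)) : Matrix (Fin 2) (Fin 2) (ZMod 5)) : ℂ) ≠ 0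
    rw [Matrix.SpecialLinearGroup.coe_one, subfieldCell_twentyfive_sharp_e_one]
    norm_num
  -- the kernel vector: `T₂ κ = d`, the relation, non-vanishing
  have hA : ∀ w : Fin 2 → QuadraticAlgebra (ZMod 5) 2 0,
      (∑ t : Matrix.SpecialLinearGroup (Fin 2) (ZMod 5), (subfieldCell_twentyfive_sharp_e (t : Matrix (Fin 2) (Fin 2) (ZMod 5)) : ℂ) *
          (subfieldCell_twentyfive_sharp_kap ((Matrix.SpecialLinearGroup.mapGL (QuadraticAlgebra (ZMod 5) 2 0) t).val *ᵥ w) : ℂ)) =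
        ((subfieldCell_twentyfive_sharp_d w : ℤ) : ℂ) := by
    intro w
    rw [← hbij.sum_comp]
    exact_mod_cast tab w (Finset.mem_univ w)
  have hκ0 : ∀ g : GL (Fin 2) (QuadraticAlgebra (ZMod 5) 2 0),
      ∑ ℓ ∈ insert ![⟨0, 0⟩, ⟨1, 0⟩] (Finset.univ.image fun x : QuadraticAlgebra (ZMod 5) 2 0 => ![⟨1, 0⟩, x]),
        ∑ t : Matrix.SpecialLinearGroup (Fin 2) (ZMod 5), (subfieldCell_twentyfive_sharp_e (t : Matrix (Fin 2) (Fin 2) (ZMod 5)) : ℂ) *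
          ((fun (_ : Fin 2 → QuadraticAlgebra (ZMod 5) 2 0) (w : Fin 2 → QuadraticAlgebra (ZMod 5) 2 0) => (subfieldCell_twentyfive_sharp_kap w : ℂ)) ℓ
            ((Matrix.SpecialLinearGroup.mapGL (QuadraticAlgebra (ZMod 5) 2 0) t).val *ᵥ ((g : Matrix (Fin 2) (Fin 2) (QuadraticAlgebra (ZMod 5) 2 0)) *ᵥ ℓ))) = 0 := by
    intro g
    have hdet : (g : Matrix (Fin 2) (Fin 2) (QuadraticAlgebra (ZMod 5) 2 0)) 0 0 * (g : Matrix (Fin 2) (Fin 2) (QuadraticAlgebra (ZMod 5) 2 0)) 1 1 - (g : Matrix (Fin 2) (Fin 2) (QuadraticAlgebra (ZMod 5) 2 0)) 0 1 * (g : Matrix (Fin 2) (Fin 2) (QuadraticAlgebra (ZMod 5) 2 0)) 1 0 ≠ 0 := by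
      rw [← Matrix.det_fin_two]
      exact ((Matrix.isUnit_iff_isUnit_det _).1 g.isUnit).ne_zero
    have hB : ∑ ℓ ∈ insert ![⟨0, 0⟩, ⟨1, 0⟩] (Finset.univ.image fun x : QuadraticAlgebra (ZMod 5) 2 0 => ![⟨1, 0⟩, x]), subfieldCell_twentyfive_sharp_d ((g : Matrix (Fin 2) (Fin 2) (QuadraticAlgebra (ZMod 5) 2 0)) *ᵥ ℓ) = 0 := by
      rcases subfieldCell_twentyfive_sharp_zmod_cases ((g : Matrix (Fin 2) (Fin 2) (QuadraticAlgebra (ZMod 5) 2 0)) 0 0).im with h | h | h | h | h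
      · exact rel0 (g : Matrix (Fin 2) (Fin 2) (QuadraticAlgebra (ZMod 5) 2 0)) (Finset.mem_univ _) h hdet
      · exact rel1 (g : Matrix (Fin 2) (Fin 2) (QuadraticAlgebra (ZMod 5) 2 0)) (Finset.mem_univ _) h hdet
      · exact rel2 (g : Matrix (Fin 2) (Fin 2) (QuadraticAlgebra (ZMod 5) 2 0)) (Finset.mem_univ _) h hdet
      · exact rel3 (g : Matrix (Fin 2) (Fin 2) (QuadraticAlgebra (ZMod 5) 2 0)) (Finset.mem_univ _) h hdet
      · exact rel4 (g : Matrix (Fin 2) (Fin 2) (QuadraticAlgebra (ZMod 5) 2 0)) (Finset.mem_univ _) h hdet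
    have hB' : ∑ ℓ ∈ insert ![⟨0, 0⟩, ⟨1, 0⟩] (Finset.univ.image fun x : QuadraticAlgebra (ZMod 5) 2 0 => ![⟨1, 0⟩, x]), ((subfieldCell_twentyfive_sharp_d ((g : Matrix (Fin 2) (Fin 2) (QuadraticAlgebra (ZMod 5) 2 0)) *ᵥ ℓ) : ℤ) : ℂ) = 0 := by
      exact_mod_cast hB
    rw [← hB']
    refine Finset.sum_congr rfl fun ℓ _ => ?_
    exact hA ((g : Matrix (Fin 2) (Fin 2) (QuadraticAlgebra (ZMod 5) 2 0)) *ᵥ ℓ)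
  have hmem : (![⟨0, 0⟩, ⟨1, 0⟩] : Fin 2 → QuadraticAlgebra (ZMod 5) 2 0) ∈ insert ![⟨0, 0⟩, ⟨1, 0⟩] (Finset.univ.image fun x : QuadraticAlgebra (ZMod 5) 2 0 => ![⟨1, 0⟩, x]) :=
    Finset.mem_insert_self _ _
  have hκ1 : ∃ ℓ ∈ insert ![⟨0, 0⟩, ⟨1, 0⟩] (Finset.univ.image fun x : QuadraticAlgebra (ZMod 5) 2 0 => ![⟨1, 0⟩, x]), ∃ w : Fin 2 → QuadraticAlgebra (ZMod 5) 2 0,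
      ∑ t : Matrix.SpecialLinearGroup (Fin 2) (ZMod 5), (subfieldCell_twentyfive_sharp_e (t : Matrix (Fin 2) (Fin 2) (ZMod 5)) : ℂ) *
          ((fun (_ : Fin 2 → QuadraticAlgebra (ZMod 5) 2 0) (w : Fin 2 → QuadraticAlgebra (ZMod 5) 2 0) => (subfieldCell_twentyfive_sharp_kap w : ℂ)) ℓ
            ((Matrix.SpecialLinearGroup.mapGL (QuadraticAlgebra (ZMod 5) 2 0) t).val *ᵥ w)) ≠ 0 := by
    refine ⟨![⟨0, 0⟩, ⟨1, 0⟩], hmem, ![⟨1, 0⟩, ⟨0, 1⟩], ?_⟩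
    show (∑ t : Matrix.SpecialLinearGroup (Fin 2) (ZMod 5), (subfieldCell_twentyfive_sharp_e (t : Matrix (Fin 2) (Fin 2) (ZMod 5)) : ℂ) *
          (subfieldCell_twentyfive_sharp_kap ((Matrix.SpecialLinearGroup.mapGL (QuadraticAlgebra (ZMod 5) 2 0) t).val *ᵥ ![⟨1, 0⟩, ⟨0, 1⟩]) : ℂ)) ≠ 0
    rw [hA]
    exact_mod_cast subfieldCell_twentyfive_sharp_nonzero
  have wall := cuspFormWall_sharp (Matrix.SpecialLinearGroup.mapGL (QuadraticAlgebra (ZMod 5) 2 0)) hφ hK Y Z hY hZ hsep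
    (fun M : Matrix.SpecialLinearGroup (Fin 2) (ZMod 5) => (subfieldCell_twentyfive_sharp_e (M : Matrix (Fin 2) (Fin 2) (ZMod 5)) : ℂ))
    he hcusp
    (fun (_ : Fin 2 → QuadraticAlgebra (ZMod 5) 2 0) (w : Fin 2 → QuadraticAlgebra (ZMod 5) 2 0) => (subfieldCell_twentyfive_sharp_kap w : ℂ)) hκ0 hκ1
  rw [h5, h25] at wall
  norm_num at wall
  exact wall

end Summit.MatrixMultiplication.MatrixMultiplication.Theorems.GradedDesignFamily.Negative
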